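import Summits.MatrixMultiplication.OmegaCensus.DihedralLawModOneRankThreeModEight
import HarnessLib

/-!
# The `|A| ≡ 1 (mod 3)` law over `A` with `dim A/2A ≥ 3`: `|A| = 208, 352, 400, 496`

ω-census, family (b3).  Framing: lottery ticket; floor = certified bounds/negative ranges.

Further instances of the mod-8 assembly `card_le_two_mul_addOrderOf_of_law_rank_three'`
(`DihedralLawModOneRankThreeModEight.lean`): for `(|A| − 1)/3 ∈ {69, 117, 133, 165}` every factorisation `cde` has two
parts `1` or a part `≢ ±1 (mod 8)` (`69 = 3·23`, `117 = 9·13` — `13 ≡ 5`, `133 = 7·19` — `19 ≡ 3`,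
`165 = 3·5·11`), so over any `A` of order `208, 352, 400, 496` with three homomorphisms onto `𝔽₂³` and all element
orders `< |A|/2` no dihedral-like group attains `3|S||T||U| + 8 = 8|A|`.  (At these orders the abelian groups of
`2`-rank `≤ 2` without a cyclic subgroup of index `≤ 2` — `ℤ₄²×ℤ₁₃`; `ℤ₄×ℤ₈×ℤ₁₁`; `ℤ₄²×ℤ₂₅, ℤ₂×ℤ₈×ℤ₂₅, ℤ₁₆×ℤ₅²,
ℤ₂×ℤ₈×ℤ₅², ℤ₄²×ℤ₅², …`; `ℤ₄²×ℤ₃₁` — remain open.)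
-/

namespace Summit.MatrixMultiplication.OmegaCensus

open Literature.Combinatorics.Additive Finset

section Arith

/-- `cde = 69` (`|A| = 208`): two parts `1`, or a part `≢ ±1 (mod 8)`. [folklore] -/
theorem cube_factor_mod_eight_208 {c d e : ℕ} (h : 3 * (c * d * e) + 1 = 208) :
    (c = 1 ∧ d = 1) ∨ (d = 1 ∧ e = 1) ∨ (c = 1 ∧ e = 1) ∨ (c % 8 ≠ 1 ∧ c % 8 ≠ 7) ∨ (d % 8 ≠ 1 ∧ d % 8 ≠ 7) ∨
      (e % 8 ≠ 1 ∧ e % 8 ≠ 7) := by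
  have hq : c * d * e = 69 := by omega
  have hc : c ∣ 69 := ⟨d * e, by rw [← hq]; ring⟩
  have hd : d ∣ 69 := ⟨c * e, by rw [← hq]; ring⟩
  have hc' : c ≤ 69 := Nat.le_of_dvd (by norm_num) hc
  have hd' : d ≤ 69 := Nat.le_of_dvd (by norm_num) hd
  have hcv : c = 1 ∨ c = 3 ∨ c = 23 ∨ c = 69 := by
    interval_cases c <;> omega
  have hdv : d = 1 ∨ d = 3 ∨ d = 23 ∨ d = 69 := by
    interval_cases d <;> omega
  rcases hcv with rfl | rfl | rfl | rfl <;> rcases hdv with rfl | rfl | rfl | rfl <;> omega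

/-- `cde = 117` (`|A| = 352`): two parts `1`, or a part `≢ ±1 (mod 8)`. [folklore] -/
theorem cube_factor_mod_eight_352 {c d e : ℕ} (h : 3 * (c * d * e) + 1 = 352) :
    (c = 1 ∧ d = 1) ∨ (d = 1 ∧ e = 1) ∨ (c = 1 ∧ e = 1) ∨ (c % 8 ≠ 1 ∧ c % 8 ≠ 7) ∨ (d % 8 ≠ 1 ∧ d % 8 ≠ 7) ∨
      (e % 8 ≠ 1 ∧ e % 8 ≠ 7) := by
  have hq : c * d * e = 117 := by omega
  have hc : c ∣ 117 := ⟨d * e, by rw [← hq]; ring⟩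
  have hd : d ∣ 117 := ⟨c * e, by rw [← hq]; ring⟩
  have hc' : c ≤ 117 := Nat.le_of_dvd (by norm_num) hc
  have hd' : d ≤ 117 := Nat.le_of_dvd (by norm_num) hd
  have hcv : c = 1 ∨ c = 3 ∨ c = 9 ∨ c = 13 ∨ c = 39 ∨ c = 117 := by
    interval_cases c <;> omega
  have hdv : d = 1 ∨ d = 3 ∨ d = 9 ∨ d = 13 ∨ d = 39 ∨ d = 117 := by
    interval_cases d <;> omega
  rcases hcv with rfl | rfl | rfl | rfl | rfl | rfl <;> rcases hdv with rfl | rfl | rfl | rfl | rfl | rfl <;> omega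

/-- `cde = 133` (`|A| = 400`): two parts `1`, or a part `≢ ±1 (mod 8)`. [folklore] -/
theorem cube_factor_mod_eight_400 {c d e : ℕ} (h : 3 * (c * d * e) + 1 = 400) :
    (c = 1 ∧ d = 1) ∨ (d = 1 ∧ e = 1) ∨ (c = 1 ∧ e = 1) ∨ (c % 8 ≠ 1 ∧ c % 8 ≠ 7) ∨ (d % 8 ≠ 1 ∧ d % 8 ≠ 7) ∨
      (e % 8 ≠ 1 ∧ e % 8 ≠ 7) := by
  have hq : c * d * e = 133 := by omega
  have hc : c ∣ 133 := ⟨d * e, by rw [← hq]; ring⟩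
  have hd : d ∣ 133 := ⟨c * e, by rw [← hq]; ring⟩
  have hc' : c ≤ 133 := Nat.le_of_dvd (by norm_num) hc
  have hd' : d ≤ 133 := Nat.le_of_dvd (by norm_num) hd
  have hcv : c = 1 ∨ c = 7 ∨ c = 19 ∨ c = 133 := by
    interval_cases c <;> omega
  have hdv : d = 1 ∨ d = 7 ∨ d = 19 ∨ d = 133 := by
    interval_cases d <;> omega
  rcases hcv with rfl | rfl | rfl | rfl <;> rcases hdv with rfl | rfl | rfl | rfl <;> omega

/-- `cde = 165` (`|A| = 496`): two parts `1`, or a part `≢ ±1 (mod 8)`. [folklore] -/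
theorem cube_factor_mod_eight_496 {c d e : ℕ} (h : 3 * (c * d * e) + 1 = 496) :
    (c = 1 ∧ d = 1) ∨ (d = 1 ∧ e = 1) ∨ (c = 1 ∧ e = 1) ∨ (c % 8 ≠ 1 ∧ c % 8 ≠ 7) ∨ (d % 8 ≠ 1 ∧ d % 8 ≠ 7) ∨
      (e % 8 ≠ 1 ∧ e % 8 ≠ 7) := by
  have hq : c * d * e = 165 := by omega
  have hc : c ∣ 165 := ⟨d * e, by rw [← hq]; ring⟩
  have hd : d ∣ 165 := ⟨c * e, by rw [← hq]; ring⟩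
  have hc' : c ≤ 165 := Nat.le_of_dvd (by norm_num) hc
  have hd' : d ≤ 165 := Nat.le_of_dvd (by norm_num) hd
  have hcv : c = 1 ∨ c = 3 ∨ c = 5 ∨ c = 11 ∨ c = 15 ∨ c = 33 ∨ c = 55 ∨ c = 165 := by
    interval_cases c <;> omega
  have hdv : d = 1 ∨ d = 3 ∨ d = 5 ∨ d = 11 ∨ d = 15 ∨ d = 33 ∨ d = 55 ∨ d = 165 := by
    interval_cases d <;> omega
  rcases hcv with rfl | rfl | rfl | rfl | rfl | rfl | rfl | rfl <;> rcases hdv with rfl | rfl | rfl | rfl | rfl | rfl | rfl | rfl <;> omega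

end Arith

section DihedralLike

variable {A : Type*} [AddCommGroup A] [DecidableEq A] [Fintype A] {G : Type} [Group G] [DecidableEq G]
  {ρ τ : A → G} {c₀ : A} {S T U : Finset G}

/-- **`|A| = 208`, `dim A/2A ≥ 3`, all element orders `< 104`: no law** (e.g. the abelian groups of order `208` of
`2`-rank `≥ 3`). [folklore] -/
theorem no_law_card_208_of_rank_three
    (hρρ : ∀ a b, ρ a * ρ b = ρ (a + b)) (hρτ : ∀ a b, ρ a * τ b = τ (b - a))
    (hτρ : ∀ a b, τ a * ρ b = τ (a + b)) (hττ : ∀ a b, τ a * τ b = ρ (c₀ + b - a))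
    (hρ : Function.Injective ρ) (hτ : Function.Injective τ) (hne : ∀ a b, ρ a ≠ τ b)
    (hsurj : ∀ g, (∃ a, ρ a = g) ∨ (∃ a, τ a = g)) (hA : Fintype.card A = 208)
    (ψ₁ ψ₂ ψ₃ : A →+ ZMod 2) (hψ : ∀ v : ZMod 2 × ZMod 2 × ZMod 2, ∃ a, (ψ₁ a, ψ₂ a, ψ₃ a) = v)
    (hord : ∀ g : A, 2 * addOrderOf g < Fintype.card A) (h : TripleProductProperty S T U) :
    3 * (S.card * T.card * U.card) + 8 ≠ 8 * Fintype.card A := by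
  intro hV
  obtain ⟨g, hg⟩ := card_le_two_mul_addOrderOf_of_law_rank_three' hρρ hρτ hτρ hττ hρ hτ hne hsurj
    (by rw [hA]; norm_num) ψ₁ ψ₂ ψ₃ hψ (fun c d e hcde => cube_factor_mod_eight_208 (by rw [hcde, hA])) h hV
  exact absurd (hord g) (not_lt.2 hg)

/-- **`|A| = 352`, `dim A/2A ≥ 3`, all element orders `< 176`: no law** (e.g. the abelian groups of order `352` of
`2`-rank `≥ 3`). [folklore] -/
theorem no_law_card_352_of_rank_three
    (hρρ : ∀ a b, ρ a * ρ b = ρ (a + b)) (hρτ : ∀ a b, ρ a * τ b = τ (b - a))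
    (hτρ : ∀ a b, τ a * ρ b = τ (a + b)) (hττ : ∀ a b, τ a * τ b = ρ (c₀ + b - a))
    (hρ : Function.Injective ρ) (hτ : Function.Injective τ) (hne : ∀ a b, ρ a ≠ τ b)
    (hsurj : ∀ g, (∃ a, ρ a = g) ∨ (∃ a, τ a = g)) (hA : Fintype.card A = 352)
    (ψ₁ ψ₂ ψ₃ : A →+ ZMod 2) (hψ : ∀ v : ZMod 2 × ZMod 2 × ZMod 2, ∃ a, (ψ₁ a, ψ₂ a, ψ₃ a) = v)
    (hord : ∀ g : A, 2 * addOrderOf g < Fintype.card A) (h : TripleProductProperty S T U) :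
    3 * (S.card * T.card * U.card) + 8 ≠ 8 * Fintype.card A := by
  intro hV
  obtain ⟨g, hg⟩ := card_le_two_mul_addOrderOf_of_law_rank_three' hρρ hρτ hτρ hττ hρ hτ hne hsurj
    (by rw [hA]; norm_num) ψ₁ ψ₂ ψ₃ hψ (fun c d e hcde => cube_factor_mod_eight_352 (by rw [hcde, hA])) h hV
  exact absurd (hord g) (not_lt.2 hg)

/-- **`|A| = 400`, `dim A/2A ≥ 3`, all element orders `< 200`: no law** (e.g. the abelian groups of order `400` of
`2`-rank `≥ 3`). [folklore] -/
theorem no_law_card_400_of_rank_three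
    (hρρ : ∀ a b, ρ a * ρ b = ρ (a + b)) (hρτ : ∀ a b, ρ a * τ b = τ (b - a))
    (hτρ : ∀ a b, τ a * ρ b = τ (a + b)) (hττ : ∀ a b, τ a * τ b = ρ (c₀ + b - a))
    (hρ : Function.Injective ρ) (hτ : Function.Injective τ) (hne : ∀ a b, ρ a ≠ τ b)
    (hsurj : ∀ g, (∃ a, ρ a = g) ∨ (∃ a, τ a = g)) (hA : Fintype.card A = 400)
    (ψ₁ ψ₂ ψ₃ : A →+ ZMod 2) (hψ : ∀ v : ZMod 2 × ZMod 2 × ZMod 2, ∃ a, (ψ₁ a, ψ₂ a, ψ₃ a) = v)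
    (hord : ∀ g : A, 2 * addOrderOf g < Fintype.card A) (h : TripleProductProperty S T U) :
    3 * (S.card * T.card * U.card) + 8 ≠ 8 * Fintype.card A := by
  intro hV
  obtain ⟨g, hg⟩ := card_le_two_mul_addOrderOf_of_law_rank_three' hρρ hρτ hτρ hττ hρ hτ hne hsurj
    (by rw [hA]; norm_num) ψ₁ ψ₂ ψ₃ hψ (fun c d e hcde => cube_factor_mod_eight_400 (by rw [hcde, hA])) h hV
  exact absurd (hord g) (not_lt.2 hg)

/-- **`|A| = 496`, `dim A/2A ≥ 3`, all element orders `< 248`: no law** (e.g. the abelian groups of order `496` of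
`2`-rank `≥ 3`). [folklore] -/
theorem no_law_card_496_of_rank_three
    (hρρ : ∀ a b, ρ a * ρ b = ρ (a + b)) (hρτ : ∀ a b, ρ a * τ b = τ (b - a))
    (hτρ : ∀ a b, τ a * ρ b = τ (a + b)) (hττ : ∀ a b, τ a * τ b = ρ (c₀ + b - a))
    (hρ : Function.Injective ρ) (hτ : Function.Injective τ) (hne : ∀ a b, ρ a ≠ τ b)
    (hsurj : ∀ g, (∃ a, ρ a = g) ∨ (∃ a, τ a = g)) (hA : Fintype.card A = 496)
    (ψ₁ ψ₂ ψ₃ : A →+ ZMod 2) (hψ : ∀ v : ZMod 2 × ZMod 2 × ZMod 2, ∃ a, (ψ₁ a, ψ₂ a, ψ₃ a) = v)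
    (hord : ∀ g : A, 2 * addOrderOf g < Fintype.card A) (h : TripleProductProperty S T U) :
    3 * (S.card * T.card * U.card) + 8 ≠ 8 * Fintype.card A := by
  intro hV
  obtain ⟨g, hg⟩ := card_le_two_mul_addOrderOf_of_law_rank_three' hρρ hρτ hτρ hττ hρ hτ hne hsurj
    (by rw [hA]; norm_num) ψ₁ ψ₂ ψ₃ hψ (fun c d e hcde => cube_factor_mod_eight_496 (by rw [hcde, hA])) h hV
  exact absurd (hord g) (not_lt.2 hg)

end DihedralLike

end Summit.MatrixMultiplication.OmegaCensus
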